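import Summits.Langlands.Langlands.Theorems.CoreAdequacySplitNoAdequateLayerLiftingStubCoprimeTableLiftingRankTwoPrelim
import Literature.GroupTheory.SpecificGroups.PGL2DicksonCharP

/-!
# RSL `CoreAdequacySplit.NoAdequateLayerLifting` (stmt-Langlands-27954), line `birth`, stub 3/3 `stub_coprimeTableLifting` — STRUCTURAL HELPERS, part 3b:
# the RANK-TWO ROWS have projective image `PSL₂(𝔽_q)` or `PGL₂(𝔽_q)` (Dickson)

Part 3a (`…RankTwoPrelim`) showed that on a rank-two coprime row (¬SADQ, `τ` an absolutely irreducible reduction over `K(ζ_ℓ)`) the projective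
image `H ≤ PGL₂(𝔽̄_ℓ)` of `τ` is finite, `ℓ`-irregular (`ℓ ∣ |H|`) and fixes no point of `ℙ¹(𝔽̄_ℓ)`.  The landed DICKSON CLASSIFICATION
(`Literature.GroupTheory.SpecificGroups.PGL2.exists_smul_eq_or_exists_conj_eq_of_five_le`, Faber 2011 Thm. B after Dickson 1901, `p ≥ 5`) then leaves
exactly one alternative: `H` is conjugate to `PSL₂(𝔽_q)` or to `PGL₂(𝔽_q)` for a finite subfield `𝔽_q ≤ 𝔽̄_ℓ`.  In the TABLE (`ℓ < 2(n+1) = 6`) this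
is the row `ℓ = 5`: the residual image over `K(ζ₅)` is projectively `PSL₂(𝔽_{5^a})` or `PGL₂(𝔽_{5^a})` up to conjugation — the «big image at
`p = 5`» world (census I-L5g11: `a = 1`, `PSL₂(𝔽₅)`, is the inadequate case).  No new definition; 0 sorry.
-/

set_option linter.dupNamespace false

namespace Summit.Langlands.Langlands.Theorems.CoreAdequacy.CoprimeTable

open scoped MatrixGroups Pointwise
open Literature.NumberTheory.GaloisRepresentations
open Literature.GroupTheory.SpecificGroups
open Summit.Langlands.Langlands.Theses

universe u

section RankTwoGroup

variable {k : Type u} [Field k]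

/-- **DICKSON PIN (group level)**: `k` algebraically closed of characteristic `ℓ ≥ 5`, `τ : G → GL₂(k)` absolutely irreducible with finite image
of order divisible by `ℓ` ⟹ the projective image of `τ` is conjugate to `PSL₂(𝔽_q)` or `PGL₂(𝔽_q)` for a finite subfield `𝔽_q ≤ k`
(landed `PGL2.exists_smul_eq_or_exists_conj_eq_of_five_le`; its fixed-point alternative is excluded by part 3a). -/
theorem projectiveImage_conj_eq_pslTwo_or_pglTwo [IsAlgClosed k] {ℓ : ℕ} [Fact ℓ.Prime] [CharP k ℓ] (h5 : 5 ≤ ℓ) {G : Type*} [Group G]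
    {τ : G →* GL (Fin 2) k} (hirr : IsAbsIrreducible τ) [Finite τ.range] (hdvd : ℓ ∣ Nat.card τ.range) :
    ∃ (F : Subfield k) (t : PGL(Fin 2, k)), Finite F ∧
      (MulAut.conj t • projectiveImage τ = PGL2.pslTwo F ∨ MulAut.conj t • projectiveImage τ = PGL2.pglTwo F) := by
  classical
  haveI : Finite (projectiveImage τ) := finite_projectiveImage τ
  rcases PGL2.exists_smul_eq_or_exists_conj_eq_of_five_le ℓ h5 (projectiveImage τ) (dvd_card_projectiveImage τ hdvd) with hfix | h
  · exact (not_exists_forall_smul_eq_of_isAbsIrreducible hirr hfix).elim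
  · exact h

end RankTwoGroup

/-! ## The rank-two rows of the residual table -/

section Table

variable {K : Type} [Field K] [NumberField K] {ℓ : ℕ} [Fact ℓ.Prime]

/-- **RANK-TWO ROWS OF THE TABLE: projective image `PSL₂(𝔽_q)` or `PGL₂(𝔽_q)`.**  For `ℓ ≥ 5`, a rank-two `ρ` with NO adequate layer (¬SADQ) and
an absolutely irreducible reduction `τ` of `ρ|Γ_{K(ζ_ℓ)}`: the projective image of `τ` is conjugate in `PGL₂(𝔽̄_ℓ)` to `PSL₂(𝔽_q)` or `PGL₂(𝔽_q)`
for a finite subfield `𝔽_q ≤ 𝔽̄_ℓ` (part 2: `ℓ ∣ |τ(Γ)|`; part 3a: Dickson's hypotheses; Dickson).  In the TABLE (`ℓ < 6`) this is the row `ℓ = 5`. -/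
theorem projectiveImage_conj_eq_pslTwo_or_pglTwo_of_rank_two_row (h5 : 5 ≤ ℓ) {ρ : FramedGaloisRep K (PadicAlgCl ℓ) 2}
    (hN : ¬ SolvablyAdequateImage ρ) {τ : Field.absoluteGaloisGroup (CyclotomicField ℓ K) →* GL (Fin 2) (padicAlgClResidueField ℓ)}
    (hτ : (ρ.restrictField (CyclotomicField ℓ K)).IsReductionOf (RingHom.id _) τ) (hirr : IsAbsIrreducible τ) :
    ∃ (F : Subfield (padicAlgClResidueField ℓ)) (t : PGL(Fin 2, padicAlgClResidueField ℓ)), Finite F ∧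
      (MulAut.conj t • projectiveImage τ = PGL2.pslTwo F ∨ MulAut.conj t • projectiveImage τ = PGL2.pglTwo F) := by
  haveI : IsAlgClosed (padicAlgClResidueField ℓ) := Literature.RingTheory.Valuation.isAlgClosed_residueField (padicAlgClIntegers ℓ)
  haveI := charP_padicAlgClResidueField ℓ
  haveI : Finite τ.range := finite_range_of_isReductionOf hτ
  have hℓ2 : ¬ ℓ ∣ 2 := fun h => by
    have h2 := Nat.le_of_dvd (by norm_num) h
    omega
  exact projectiveImage_conj_eq_pslTwo_or_pglTwo h5 hirr (dvd_card_image_of_coprime_row hℓ2 hN hτ hirr)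

/-- **CycIrr-form for the TABLE stub's hypotheses** (`n = 2`, `5 ≤ ℓ`, `CycIrr ρ`, `¬ SolvablyAdequateImage ρ`): some absolutely irreducible
reduction of `ρ|Γ_{K(ζ_ℓ)}` has projective image conjugate to `PSL₂(𝔽_q)` or `PGL₂(𝔽_q)`, `𝔽_q ≤ 𝔽̄_ℓ` finite. -/
theorem exists_projectiveImage_conj_eq_of_rank_two_row (h5 : 5 ≤ ℓ) {ρ : FramedGaloisRep K (PadicAlgCl ℓ) 2} (hc : CycIrr ρ)
    (hN : ¬ SolvablyAdequateImage ρ) :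
    ∃ τ : Field.absoluteGaloisGroup (CyclotomicField ℓ K) →* GL (Fin 2) (padicAlgClResidueField ℓ),
      (ρ.restrictField (CyclotomicField ℓ K)).IsReductionOf (RingHom.id _) τ ∧ IsAbsIrreducible τ ∧
        ∃ (F : Subfield (padicAlgClResidueField ℓ)) (t : PGL(Fin 2, padicAlgClResidueField ℓ)), Finite F ∧
          (MulAut.conj t • projectiveImage τ = PGL2.pslTwo F ∨ MulAut.conj t • projectiveImage τ = PGL2.pglTwo F) := by
  obtain ⟨τ, hτ, hirr⟩ := hc
  exact ⟨τ, hτ, hirr, projectiveImage_conj_eq_pslTwo_or_pglTwo_of_rank_two_row h5 hN hτ hirr⟩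

end Table

end Summit.Langlands.Langlands.Theorems.CoreAdequacy.CoprimeTable
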